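import Literature.AlgebraicGeometry.HodgeTheory.CMHodgeGroupNoTwist
import Literature.AlgebraicGeometry.HodgeTheory.CMHodgeGroupIrreducibleBlocks
import HarnessLib

/-!
# `Lie Hg ⊗ ℂ ⊇ 𝔲_E(V,ψ) ⊗ ℂ` for a CM field of degree `≤ 6` acting with multiplicity `2` and exactly one
# `Θ`-scalar place (e.g. the sextic CM pattern `(n_σ) = (2,1,1)`) — the Lie step of «`Hg = U_E`»
# (Moonen–Zarhin 1999 §2 (2.3); Ribet 1983 Thm. 0)

Family `hodge`, layer `Literature/AlgebraicGeometry/HodgeTheory` (brick P5, Hodge-structure half, of the design note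
`HOME/jobs/A7-inventory-eng5g6/DESIGN-rows10-12-allmembers.md` of the cell `pub-hodgeav-hg6`, req-37 (A) Q2b, TABLE X row 12
ALL MEMBERS, pattern `(2,1,1)`). UNCONDITIONAL; theorems only, no definition, no named fact, no `sorry`. HONEST FRAMING of that
cell: HC / HC_AV / HC_CM / H2 NOT proved — this file is linear algebra of polarized weight-one `ℚ`-Hodge structures (it
discharges the hypothesis `hU` of the cell's census row `census_row12_sexticGeneral` for the members of pattern `(2,1,1)`,
see the geometric companion).

ASSEMBLY: `CMThetaSocket.mem_spanC_of_lift_of_centre` (socket) ← LIFT (`CMNoTwist.lift_of_unique_unbalanced`, with the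
irreducibility `CMIrred.eigenspace_irreducible`) + CENTRE (`CMThetaCentre.centre_of_single`).
* **`CMThetaOneScalar.mem_spanC_of_commute_of_skew`** — for an effective polarized weight-one `H` with `End_Hdg(V) = E =
  ℚ[φ]` of dimension `2|ι|`, `|ι| ≤ 3`, every non-zero element invertible, a CM type `μ : ι → ℂ` with all blocks `W_c`
  planes spanning `V_ℂ`, ONE place `k₀` with `W_{μ k₀} ⊆ V^{1,0}` or `⊆ V^{0,1}` and the others balanced, and ANY
  bracket-closed `𝔤 ⊆ End_ℚ(V)` commuting with `E`, `ψ`-skew, with `Θ ∈ 𝔤_ℂ`: every `φ_ℂ`-commuting `ψ_ℂ`-skew operator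
  lies in `𝔤_ℂ`.
* **`CMThetaOneScalar.mem_hodgeLieC_of_commute_of_skew`** — the case `𝔤 = Lie Hg(H)`: `Lie Hg(H)_ℂ ⊇ 𝔲_E(V,ψ)_ℂ`.

## References
* [MoonenZarhin1999LowDim] B. Moonen, Yu. Zarhin, Math. Ann. 315 (1999), §2 (2.3), (1.8).
* [Ribet1983] K. A. Ribet, Amer. J. Math. 105 (1983), Thm. 0, §3.
* [Deligne1982HodgeCycles] P. Deligne, LNM 900 (1982), I §3 Prop. 3.4, §4 (p. 30).
-/

noncomputable section

open scoped TensorProduct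
open Module

namespace Literature.AlgebraicGeometry.Motives

namespace HodgeStructure

universe u

variable {V : Type u} [AddCommGroup V] [Module ℚ V] {n : ℤ}

/-- **`𝔤_ℂ ⊇ 𝔲_E(V,ψ)_ℂ` FOR A CM FIELD WITH ONE `Θ`-SCALAR PLACE** (see the module docstring).
[cite: MoonenZarhin1999LowDim, §2 (2.3)] [cite: Ribet1983, Thm. 0] [cite: Deligne1982HodgeCycles, I §3 Prop. 3.4] -/
theorem CMThetaOneScalar.mem_spanC_of_commute_of_skew [Module.Finite ℚ V] [HodgeTensorFacts.{u, u}] {ι : Type}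
    [Fintype ι] [DecidableEq ι] (hι : Fintype.card ι ≤ 3)
    (H : HodgeStructure V n) (hn : n = 1) (heff : H.IsEffective) (ψ : H.Polarization)
    {φ : Module.End ℚ V} (hφE : φ ∈ H.endAlg) {m : ℕ} (hE : ∀ a ∈ H.endAlg, ∃ q : Fin m → ℚ, a = ∑ k, q k • φ ^ (k : ℕ))
    (hEdim : Module.finrank ℚ H.endAlg = 2 * Fintype.card ι)
    (hdiv : ∀ a ∈ H.endAlg, a ≠ 0 → ∃ b : Module.End ℚ V, b * a = 1)
    (μ : ι → ℂ) (hinj : Function.Injective μ) (hdist : ∀ k k', μ k' ≠ starRingEnd ℂ (μ k))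
    (hrank : ∀ k, Module.finrank ℂ ↥(Module.End.eigenspace (φ.baseChange ℂ) (μ k) ⊓ H.piece 1 0) +
      Module.finrank ℂ ↥(Module.End.eigenspace (φ.baseChange ℂ) (μ k) ⊓ H.piece 0 1) = 2)
    (htop : (⨆ kt : ι × Fin 2, Module.End.eigenspace (φ.baseChange ℂ)
      (if kt.2 = 0 then μ kt.1 else starRingEnd ℂ (μ kt.1))) = ⊤)
    (𝔤 : Submodule ℚ (Module.End ℚ V)) (hbr : ∀ X ∈ 𝔤, ∀ X' ∈ 𝔤, X * X' - X' * X ∈ 𝔤)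
    (hcomm : ∀ X ∈ 𝔤, ∀ a : H.endAlg, X * (a : Module.End ℚ V) = (a : Module.End ℚ V) * X)
    (hskew : ∀ X ∈ 𝔤, ∀ v w, ψ.form (X v) w + ψ.form v (X w) = 0)
    {Θ : Module.End ℂ (ℂ ⊗[ℚ] V)} (hΘ : ∀ p, ∀ x ∈ H.piece p (n - p), Θ x = ((2 * p - n : ℤ) : ℂ) • x)
    (hΘ𝔤 : Θ ∈ spanC 𝔤)
    (k₀ : ι) (hk₀ : Module.finrank ℂ ↥(Module.End.eigenspace (φ.baseChange ℂ) (μ k₀) ⊓ H.piece 1 0) = 0 ∨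
      Module.finrank ℂ ↥(Module.End.eigenspace (φ.baseChange ℂ) (μ k₀) ⊓ H.piece 0 1) = 0)
    (hbal : ∀ k, k ≠ k₀ → Module.finrank ℂ ↥(Module.End.eigenspace (φ.baseChange ℂ) (μ k) ⊓ H.piece 1 0) ≠ 0 ∧
      Module.finrank ℂ ↥(Module.End.eigenspace (φ.baseChange ℂ) (μ k) ⊓ H.piece 0 1) ≠ 0)
    {Y : Module.End ℂ (ℂ ⊗[ℚ] V)} (hYφ : Y * φ.baseChange ℂ = φ.baseChange ℂ * Y)
    (hYskew : ∀ x y, ψ.form.baseChange ℂ (Y x) y + ψ.form.baseChange ℂ x (Y y) = 0) : Y ∈ spanC 𝔤 := by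
  classical
  have hirr := fun k U hUW hU => CMIrred.eigenspace_irreducible H hn heff ψ hφE hE μ hinj hdist htop 𝔤 hΘ hΘ𝔤 hcomm
    hskew k U hUW hU
  have hlift := fun k Z hZ => CMNoTwist.lift_of_unique_unbalanced hι H hn heff ψ hφE hE hdiv μ hinj hdist hrank htop 𝔤
    hbr hcomm hskew hΘ hΘ𝔤 hirr k₀ hk₀ hbal k Z hZ
  -- `φ† ≠ φ`: `φ†` acts on `W_{μ k₀} ≠ 0` by `conj (μ k₀) ≠ μ k₀`
  have hφadj : ψ.adjoint φ ≠ φ := by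
    intro h
    have hfin : Module.finrank ℂ ↥(Module.End.eigenspace (φ.baseChange ℂ) (μ k₀)) = 2 := by
      rw [CMTheta.finrank_eigenspace_eq_add H hn heff hφE, hrank k₀]
    obtain ⟨w, hw, hw0⟩ := Submodule.exists_mem_ne_zero_of_ne_bot
      (fun h0 => by rw [h0, finrank_bot] at hfin; exact two_ne_zero hfin.symm :
        Module.End.eigenspace (φ.baseChange ℂ) (μ k₀) ≠ ⊥)
    have h1 := CMNoTwist.adjoint_baseChange_apply H hn heff ψ hφE hE μ hinj hdist two_ne_zero hrank htop k₀ w hw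
    rw [h, Module.End.mem_eigenspace_iff.1 hw] at h1
    exact hdist k₀ k₀ (smul_left_injective ℂ hw0 h1)
  have hbal' : ∀ k, k ≠ k₀ → Module.finrank ℂ ↥(Module.End.eigenspace (φ.baseChange ℂ) (μ k) ⊓ H.piece 1 0) =
      Module.finrank ℂ ↥(Module.End.eigenspace (φ.baseChange ℂ) (μ k) ⊓ H.piece 0 1) := fun k hk => by
    have h := hrank k; have h' := hbal k hk; omega
  have hk₀' : Module.finrank ℂ ↥(Module.End.eigenspace (φ.baseChange ℂ) (μ k₀) ⊓ H.piece 1 0) ≠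
      Module.finrank ℂ ↥(Module.End.eigenspace (φ.baseChange ℂ) (μ k₀) ⊓ H.piece 0 1) := by
    have h := hrank k₀; omega
  have hcentre := CMThetaCentre.centre_of_single H hn heff ψ hφE hE hEdim hdiv hφadj μ hinj hdist two_ne_zero hrank
    htop 𝔤 hcomm hskew hΘ hΘ𝔤 hlift k₀ hbal' hk₀'
  exact CMThetaSocket.mem_spanC_of_lift_of_centre H hn heff ψ hφE hE μ hinj hdist htop 𝔤 hcomm hskew hlift hcentre
    hYφ hYskew

/-- **`Lie Hg(H)_ℂ ⊇ 𝔲_E(V,ψ)_ℂ` FOR A CM FIELD WITH ONE `Θ`-SCALAR PLACE**: every `φ_ℂ`-commuting `ψ_ℂ`-skew operator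
of `V_ℂ` lies in `Lie Hg(H) ⊗ ℂ` — the hypothesis `hU` of the cell's census rows for these members (`Lie Hg(H)` is
bracket-closed, commutes with `End_Hdg`, is `ψ`-skew and `Θ ∈ Lie Hg ⊗ ℂ`). [cite: MoonenZarhin1999LowDim, §2 (2.3)]
[cite: Ribet1983, Thm. 0] [cite: Deligne1982HodgeCycles, I §3 Prop. 3.4] -/
theorem CMThetaOneScalar.mem_hodgeLieC_of_commute_of_skew [Module.Finite ℚ V] [HodgeTensorFacts.{u, u}] {ι : Type}
    [Fintype ι] [DecidableEq ι] (hι : Fintype.card ι ≤ 3)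
    (H : HodgeStructure V n) (hn : n = 1) (heff : H.IsEffective) (ψ : H.Polarization)
    {φ : Module.End ℚ V} (hφE : φ ∈ H.endAlg) {m : ℕ} (hE : ∀ a ∈ H.endAlg, ∃ q : Fin m → ℚ, a = ∑ k, q k • φ ^ (k : ℕ))
    (hEdim : Module.finrank ℚ H.endAlg = 2 * Fintype.card ι)
    (hdiv : ∀ a ∈ H.endAlg, a ≠ 0 → ∃ b : Module.End ℚ V, b * a = 1)
    (μ : ι → ℂ) (hinj : Function.Injective μ) (hdist : ∀ k k', μ k' ≠ starRingEnd ℂ (μ k))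
    (hrank : ∀ k, Module.finrank ℂ ↥(Module.End.eigenspace (φ.baseChange ℂ) (μ k) ⊓ H.piece 1 0) +
      Module.finrank ℂ ↥(Module.End.eigenspace (φ.baseChange ℂ) (μ k) ⊓ H.piece 0 1) = 2)
    (htop : (⨆ kt : ι × Fin 2, Module.End.eigenspace (φ.baseChange ℂ)
      (if kt.2 = 0 then μ kt.1 else starRingEnd ℂ (μ kt.1))) = ⊤)
    (k₀ : ι) (hk₀ : Module.finrank ℂ ↥(Module.End.eigenspace (φ.baseChange ℂ) (μ k₀) ⊓ H.piece 1 0) = 0 ∨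
      Module.finrank ℂ ↥(Module.End.eigenspace (φ.baseChange ℂ) (μ k₀) ⊓ H.piece 0 1) = 0)
    (hbal : ∀ k, k ≠ k₀ → Module.finrank ℂ ↥(Module.End.eigenspace (φ.baseChange ℂ) (μ k) ⊓ H.piece 1 0) ≠ 0 ∧
      Module.finrank ℂ ↥(Module.End.eigenspace (φ.baseChange ℂ) (μ k) ⊓ H.piece 0 1) ≠ 0)
    {Y : Module.End ℂ (ℂ ⊗[ℚ] V)} (hYφ : Y * φ.baseChange ℂ = φ.baseChange ℂ * Y)
    (hYskew : ∀ x y, ψ.form.baseChange ℂ (Y x) y + ψ.form.baseChange ℂ x (Y y) = 0) : Y ∈ H.hodgeLieC := by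
  obtain ⟨Θ, hΘ⟩ := exists_hodgeTheta H
  have hΘ𝔤 : Θ ∈ spanC H.hodgeLie := (hodgeLieC_eq_spanC H) ▸ H.mem_hodgeLieC_of_forall_piece hΘ
  rw [hodgeLieC_eq_spanC]
  exact CMThetaOneScalar.mem_spanC_of_commute_of_skew hι H hn heff ψ hφE hE hEdim hdiv μ hinj hdist hrank htop H.hodgeLie
    (fun X hX X' hX' => H.commutator_mem_hodgeLie hX hX') (fun X hX a => H.commute_of_mem_hodgeLie hX a)
    (fun X hX => form_apply_add_eq_zero_of_mem_hodgeLie ψ hX) hΘ hΘ𝔤 k₀ hk₀ hbal hYφ hYskew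

end HodgeStructure

end Literature.AlgebraicGeometry.Motives
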